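import Literature.NumberTheory.Transcendental.CalegariDimitrovTangL2Chi3Reduction

/-!
# `NormalFormPrinciple` (stmt-KontsevichZagierPeriods-3869), line `SketchIdeator1` —
# the leaf `stub_boxRigidity` in dimension two, level one: rigidity of the normal form's numbers

Pure proof file (stub `levelOne_rigid_numbers` of the dimension-two layer, lead seat c7;
`--supports` the crux). Every representation `[(0,1)², P(x,y)/(1 − xy)]`, `P ∈ ℚ[x,y]`, reduces by
KZ moves to the normal form `[(0,1)², β/(1 − xy)] + [pt, q]` of value `β·π²/6 + q`
(`β, q ∈ ℚ`, `∫∫ dx dy/(1 − xy) = ζ(2) = π²/6`). This file is the arithmetic rigidity of that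
normal form: equal values force equal coefficients, because `π²` is irrational (Legendre 1794;
in the tree unconditionally from Lindemann, `CalegariDimitrovTang.irrational_pi_sq`, packaged as
the coefficient comparison `CalegariDimitrovTang.eq_zero_of_add_mul_pi_sq_eq_zero`).

Sources: M. Kontsevich, D. Zagier, *Periods* (2001), §1.1–1.2; F. Calegari, V. Dimitrov, Y. Tang,
arXiv:2408.15403, remark after Cor. 2 (p. 3) (Legendre). No definitions are introduced.
-/

noncomputable section

open Literature.NumberTheory.Transcendental

namespace Summit.KontsevichZagierPeriods.HurwitzMicroSectors.NormalFormPrinciple.PiBox.LevelOne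

/-- **Rigidity of the level-one normal form.** If `β·π²/6 + q = β'·π²/6 + q'` with
`β, q, β', q' ∈ ℚ`, then `β = β'` and `q = q'`: the difference is the `ℚ`-linear relation
`(q − q') + ((β − β')/6)·π² = 0`, whose coefficients vanish since `1, π²` are `ℚ`-linearly
independent (`π²` irrational, Legendre; unconditional in the tree via Lindemann).
[cite: CalegariDimitrovTang2024, remark after Cor. 2 (p. 3)] [folklore] -/
theorem levelOne_rigid_numbers (β q β' q' : ℚ)
    (h : (β : ℝ) * (Real.pi ^ 2 / 6) + q = (β' : ℝ) * (Real.pi ^ 2 / 6) + q') :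
    β = β' ∧ q = q' := by
  have h0 : ((q - q' : ℚ) : ℝ) + ((β - β') / 6 : ℚ) * Real.pi ^ 2 = 0 := by
    push_cast
    linear_combination h
  obtain ⟨hq, hβ⟩ := CalegariDimitrovTang.eq_zero_of_add_mul_pi_sq_eq_zero _ _ h0
  exact ⟨by linarith, sub_eq_zero.mp hq⟩

end Summit.KontsevichZagierPeriods.HurwitzMicroSectors.NormalFormPrinciple.PiBox.LevelOne
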